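import Summits.HodgeConjecture.HodgeConjecture.Theorems.F0P3SpectralPacketOfAPackets   -- ★ (N) FILE 3c p842143 (F0P2-p01 (g9)): `IsPacketOf` (+ `.fin_eq`, `.fin_eq_ofAPackets`, …), `GlobalPacketH.charPacket` (ℓ8); FILE 3a∕3b∕1c∕2∕1
import Summits.HodgeConjecture.HodgeConjecture.Theorems.F0P3XiLocalCharOpenKernel      -- ★ rider (d) p842233 (F0P2-p01 (g9)): `isOpen_ker_xiLocalChar L ξ v` (+ ★ `Rogawski1990.XiLocalCharacter`: `ξ.xiLocalChar v`)
import HarnessLib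

/-!
# (N) DEFS, FILE 3e — `Π(ξ)` AND `ξ` AS ELEMENTS OF THE SPECTRAL TUPLE: the letter shape «`Π(ξ)` is a (discrete) global packet of `G`» (`XiPacketsDiscrete`), the slot
# `PiXi ξ := piXi …` it delivers, and the hypothesis-free slot `ρXi ξ := rhoXi …` (Rogawski §13.3 Thm. 13.3.6 (b) p. 202; §13.1 Prop. 13.1.3 (d) p. 199; §12.3 Prop. 12.3.3 p. 178; §12.1)

Cell `hodgecm-mathlib` (D-0151), F0∕P3 «U3-mult», crux H413 (`stmt-HodgeConjecture-24833`), route of record `HCCMUnconditional`.  LEAD F0P3a-plan (g9) WORD T8-141 (1) (b)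
««`Π(ξ)` IS DISCRETE» after (a), census-first»; census `F0/P3a/F0P3a-p01/g12/CENSUS-N-FILE3e-PiXi-rhoXi.F0P3a-p01g12.md` 0d16872e (F0P3a-p01 (g12), (N) lead pen); (N) board of
record F0P2-p01 (g9) `BOARD-N-DEFS-handoff` 4a1a16d9 §B2.  Definition lane (one `Prop`-predicate + two data `def`s) + one-line read-backs; namespaces of ★ FILE 3a
(`…F0P3SpectralPacket.SpectralPacketG`) and ★ FILE 2 (`…F0P3GlobalPacket.GlobalPacketH`); GENERIC in the Hermitian form `H′` and in the A-packet data `Pk`, `PkInf` (★ FILE 3c's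
convention: consumers plug ★ `xiPacketFamilyOfRecordSCD … ξ` ∕ ★ `archPacketOfRecord ι μω jInf dsInf ξ` at their frame); box-before-file (B-typ03); `--supports
stmt-HodgeConjecture-24833 --as helper`.  No instance, no notation, no named fact, no `sorry`; no `Classical` instance in any statement (the choice lives inside `piXi`'s body).
HONEST LABEL: HC_CM is proved only modulo the printed citations until rung 0 closes; this file proves no printed statement — it NAMES the letter shape the STF-side junction
will take as ONE hypothesis `hXi` and reads back the two tuple slots it determines.

PRINT.  [§13.3 Thm. 13.3.6 (b) p. 202] for `ξ ∈ Π(H)` one-dimensional, `π = ⊗ πⁿ(ξ_v)` (and the members of `Π(ξ)` with an even number of `πˢ`) occur in the discrete spectrum with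
`m(π) = 1` — so `Π(ξ) = ⊗_v Π(ξ_v)` IS a discrete global packet [§13.3 p. 201 ¶2 «`Π` is discrete if some member occurs discretely»]; [§13.1 Prop. 13.1.3 (d) p. 199] `Π(ξ_v) =
{πⁿ(ξ_v), πˢ(ξ_v)}` with `⟨ξ, ·⟩ ≡ 1`; [§12.3 Prop. 12.3.3 p. 178] `Π(ξ_∞) = {J^±, D}`; [§12.1] one-dimensional representations of `H_v` are singleton packets (type (3)).

CONTENTS.
* §1 (e1) **`SpectralPacketG.XiPacketsDiscrete 𝔩 𝔞 μ Pk PkInf : Prop := ∀ ξ, ∃ Q : SpectralPacketG 𝔩 𝔞 μ, Q.IsPacketOf (Pk ξ) (PkInf ξ)`** — the letter shape.  Honest bundle: the ∃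
  carries three kit-structural parts (a local packet containing each `Π(ξ_v)` — (ℓ6) `ContainsAPacket`; cofinitely unramified; an archimedean packet containing `Π(ξ_∞)` —
  `ContainsAPacketInf`) + the PRINTED discreteness `fin.IsDiscrete μ`.
* §2 (e2) **`SpectralPacketG.piXi h ξ := (h ξ).choose`** — THE TUPLE'S `PiXi ξ`; `piXi_isPacketOf`, `mem_piXi_fin_iff`, `one_piXi_fin_πn`, `memInf_piXi_iff`, `fin_eq_piXi_fin`
  (under (ℓ7) `UniqLaw` and non-supercuspidal `πⁿ_v` the finite part of ANY witness is `(piXi h ξ).fin` — the choice is immaterial there, ★ `IsPacketOf.fin_eq`), `piXi_fin_eq_ofAPackets`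
  (bridge to ★ FILE 3b `ofAPackets`), `memInf_eq_memInf_piXi` (board (o-b1): `inf` is pinned by its member set only), `piXi_exists_mem_occurs` (the discrete witness).
* §3 (e3) **`GlobalPacketH.rhoXi h8 ξ := charPacket h8 (ξ_v)_v …`** — THE TUPLE'S `ρXi ξ`, hypothesis-free but for (ℓ8) `OneDimHLaw` (the open-kernel side condition is ★
  `isOpen_ker_xiLocalChar`); `rhoXi_isCharPacket`, `eq_rhoXi_of_isCharPacket` (uniqueness), `memH_rhoXi_loc`, `rhoXi_loc`.

References: [Rogawski1990] §13.3 Thm. 13.3.6 (b) p. 202, p. 201 ¶2; §13.1 Prop. 13.1.3 (d) p. 199; §12.3 Prop. 12.3.3 p. 178; §12.1 p. 171.  [BushnellHenniart2006] §1.5 (open kernels).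
-/

set_option autoImplicit false
-- the mandated namespace repeats `HodgeConjecture.HodgeConjecture`, as in every `Theorems/*.lean` of this sub-problem
set_option linter.dupNamespace false

noncomputable section

open NumberField IsDedekindDomain MeasureTheory
open scoped Matrix MatrixGroups

open Literature.NumberTheory Literature.NumberTheory.Automorphic Literature.NumberTheory.Automorphic.UnitaryGroup
open Literature.NumberTheory.Rogawski1990 Literature.NumberTheory.GaloisRepresentations
open Literature.RepresentationTheory.BorelWallach2000 Literature.RepresentationTheory.KonnoKonno2007
open Summit.HodgeConjecture.HodgeConjecture.Cruxes.H413.F0P3LocalPacketKit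
open Summit.HodgeConjecture.HodgeConjecture.Cruxes.H413.F0P3ArchPacketKit

/-! ## §1–§2 The letter shape and the slot `PiXi` [Thm. 13.3.6 (b); Prop. 13.1.3 (d); Prop. 12.3.3] -/

namespace Summit.HodgeConjecture.HodgeConjecture.Cruxes.H413.F0P3SpectralPacket.SpectralPacketG

open Summit.HodgeConjecture.HodgeConjecture.Cruxes.H413.F0P3GlobalPacket

variable {L : Type} [Field L] [NumberField L] [IsCMField L] {H' : Matrix (Fin 3) (Fin 3) L}

/-- **(e1) `XiPacketsDiscrete 𝔩 𝔞 μ Pk PkInf` — «FOR EVERY ONE-DIMENSIONAL AUTOMORPHIC `ξ` OF `H`, `Π(ξ) = ⊗_v Π(ξ_v) ⊗ Π(ξ_∞)` IS A DISCRETE GLOBAL PACKET OF `G`»**: for every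
`ξ : OneDimAutRepH L` there is a discrete spectral packet `Q` (★ FILE 3a: finite-place packet + archimedean packet + `IsDiscrete μ`) which IS the packet of the A-packet data
`(Pk ξ, PkInf ξ)` (★ FILE 3c `IsPacketOf`: at every finite `v` the local packet has members `{πⁿ(ξ_v)} ∪ πˢ(ξ_v)` with `⟨1, πⁿ⟩ = 1`; at `∞` members `Π(ξ_∞)` with `⟨1, πⁿ_∞⟩ = 1`).
The A-packet data are parameters (consumers: `Pk := xiPacketFamilyOfRecordSCD …`, `PkInf := archPacketOfRecord ι μω jInf dsInf`).  Print: Thm. 13.3.6 (b) (`⊗ πⁿ(ξ_v)` occurs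
discretely with `m = 1`, so `Π(ξ)` is discrete, p. 201 ¶2), Prop. 13.1.3 (d), Prop. 12.3.3; the three kit-structural parts of the ∃ (a local ∕ archimedean packet containing the
A-packet exists; cofinite unramifiedness) are print's «`Π(ξ_v)` is a packet». [cite: Rogawski1990, §13.3 Thm. 13.3.6 (b) p. 202; §13.1 Prop. 13.1.3 (d) p. 199; §12.3 Prop. 12.3.3 p. 178] -/
def XiPacketsDiscrete (𝔩 : ∀ v : HeightOneSpectrum (𝓞 ↥(maximalRealSubfield L)), LocalPacketKit L H' v) (𝔞 : ArchPacketKit)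
    (μ : Measure (adelicGroupData (↥(maximalRealSubfield L)) L (IsCMField.complexConj L) 3 H').automorphicQuotient)
    [SMulInvariantMeasure (adelicGroupData (↥(maximalRealSubfield L)) L (IsCMField.complexConj L) 3 H').Adelic
      (adelicGroupData (↥(maximalRealSubfield L)) L (IsCMField.complexConj L) 3 H').automorphicQuotient μ]
    (Pk : OneDimAutRepH L → ∀ v : HeightOneSpectrum (𝓞 ↥(maximalRealSubfield L)), CMLocalAPacket L H' v)
    (PkInf : OneDimAutRepH L → LocalAPacket (GKIrrClass (uFormGroup (Fin 2) (Fin 1)))) : Prop :=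
  ∀ ξ : OneDimAutRepH L, ∃ Q : SpectralPacketG 𝔩 𝔞 μ, Q.IsPacketOf (Pk ξ) (PkInf ξ)

variable {𝔩 : ∀ v : HeightOneSpectrum (𝓞 ↥(maximalRealSubfield L)), LocalPacketKit L H' v} {𝔞 : ArchPacketKit}
  {μ : Measure (adelicGroupData (↥(maximalRealSubfield L)) L (IsCMField.complexConj L) 3 H').automorphicQuotient}
  [SMulInvariantMeasure (adelicGroupData (↥(maximalRealSubfield L)) L (IsCMField.complexConj L) 3 H').Adelic
    (adelicGroupData (↥(maximalRealSubfield L)) L (IsCMField.complexConj L) 3 H').automorphicQuotient μ]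
  {Pk : OneDimAutRepH L → ∀ v : HeightOneSpectrum (𝓞 ↥(maximalRealSubfield L)), CMLocalAPacket L H' v}
  {PkInf : OneDimAutRepH L → LocalAPacket (GKIrrClass (uFormGroup (Fin 2) (Fin 1)))}

/-- Unfolding of (e1). [cite: Rogawski1990, §13.3 Thm. 13.3.6 (b) p. 202] -/
theorem xiPacketsDiscrete_iff :
    XiPacketsDiscrete 𝔩 𝔞 μ Pk PkInf ↔ ∀ ξ : OneDimAutRepH L, ∃ Q : SpectralPacketG 𝔩 𝔞 μ, Q.IsPacketOf (Pk ξ) (PkInf ξ) :=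
  Iff.rfl

/-- **(e2) `piXi h ξ` — THE TUPLE'S `PiXi ξ = Π(ξ)`**: the discrete packet the letter delivers (a choice of witness; its finite part is canonical under (ℓ7), `fin_eq_piXi_fin`,
its archimedean member set is canonical, `memInf_eq_memInf_piXi`). [cite: Rogawski1990, §13.3 Thm. 13.3.6 (b) p. 202; §13.1 p. 199] -/
def piXi (h : XiPacketsDiscrete 𝔩 𝔞 μ Pk PkInf) (ξ : OneDimAutRepH L) : SpectralPacketG 𝔩 𝔞 μ :=
  (h ξ).choose

/-- `Π(ξ)` IS the packet of `(Pk ξ, PkInf ξ)`. [cite: Rogawski1990, §13.1 Prop. 13.1.3 (d) p. 199; §12.3 Prop. 12.3.3 p. 178] -/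
theorem piXi_isPacketOf (h : XiPacketsDiscrete 𝔩 𝔞 μ Pk PkInf) (ξ : OneDimAutRepH L) : (piXi h ξ).IsPacketOf (Pk ξ) (PkInf ξ) :=
  (h ξ).choose_spec

/-- Members of `Π(ξ)_v` are `{πⁿ(ξ_v)} ∪ πˢ(ξ_v)`. [cite: Rogawski1990, §13.1 Prop. 13.1.3 (d) p. 199] -/
theorem mem_piXi_fin_iff (h : XiPacketsDiscrete 𝔩 𝔞 μ Pk PkInf) (ξ : OneDimAutRepH L) (v : HeightOneSpectrum (𝓞 ↥(maximalRealSubfield L)))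
    (c : IrrClass ((UnitaryGroup.cmDatum L 3 H').Local v)) :
    c ∈ (𝔩 v).mem ((piXi h ξ).fin.loc v) ↔ (c = (Pk ξ v).πn ∨ (Pk ξ v).πs = some c) :=
  (piXi_isPacketOf h ξ).mem_fin_iff v c

/-- `⟨1, πⁿ(ξ_v)⟩ = 1` in `Π(ξ)_v`. [cite: Rogawski1990, §13.1 p. 199] -/
theorem one_piXi_fin_πn (h : XiPacketsDiscrete 𝔩 𝔞 μ Pk PkInf) (ξ : OneDimAutRepH L) (v : HeightOneSpectrum (𝓞 ↥(maximalRealSubfield L))) :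
    (𝔩 v).one ((piXi h ξ).fin.loc v) (Pk ξ v).πn = 1 :=
  (piXi_isPacketOf h ξ).one_fin_πn v

/-- Members of `Π(ξ)_∞` are `Π(ξ_∞)`. [cite: Rogawski1990, §12.3 Prop. 12.3.3 p. 178] -/
theorem memInf_piXi_iff (h : XiPacketsDiscrete 𝔩 𝔞 μ Pk PkInf) (ξ : OneDimAutRepH L) (c : GKIrrClass (uFormGroup (Fin 2) (Fin 1))) :
    c ∈ 𝔞.memInf (piXi h ξ).inf ↔ (c = (PkInf ξ).πn ∨ (PkInf ξ).πs = some c) :=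
  (piXi_isPacketOf h ξ).mem_inf_iff c

/-- **The choice is immaterial on the finite part** (under (ℓ7) `UniqLaw` everywhere and non-supercuspidal `πⁿ(ξ_v)` — print: a principal-series constituent): any discrete
packet OF the same data has finite part `(piXi h ξ).fin` (★ `IsPacketOf.fin_eq`). [cite: Rogawski1990, §13.1 p. 199; §13.3 p. 201 ¶2] -/
theorem fin_eq_piXi_fin (h : XiPacketsDiscrete 𝔩 𝔞 μ Pk PkInf) (ξ : OneDimAutRepH L)
    (h𝔩 : ∀ v : HeightOneSpectrum (𝓞 ↥(maximalRealSubfield L)), (𝔩 v).UniqLaw)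
    (hn : ∀ v : HeightOneSpectrum (𝓞 ↥(maximalRealSubfield L)), ¬ (Pk ξ v).πn.IsSupercuspidal)
    {Q' : SpectralPacketG 𝔩 𝔞 μ} (hQ' : Q'.IsPacketOf (Pk ξ) (PkInf ξ)) : Q'.fin = (piXi h ξ).fin :=
  hQ'.fin_eq h𝔩 hn (piXi_isPacketOf h ξ)

/-- **Bridge to ★ FILE 3b's data form**: `(piXi h ξ).fin = ofAPackets (Pk ξ) hc hunr` for any admissible `hc`, `hunr`. [cite: Rogawski1990, §13.3 p. 201 ¶2] -/
theorem piXi_fin_eq_ofAPackets (h : XiPacketsDiscrete 𝔩 𝔞 μ Pk PkInf) (ξ : OneDimAutRepH L)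
    (h𝔩 : ∀ v : HeightOneSpectrum (𝓞 ↥(maximalRealSubfield L)), (𝔩 v).UniqLaw)
    (hn : ∀ v : HeightOneSpectrum (𝓞 ↥(maximalRealSubfield L)), ¬ (Pk ξ v).πn.IsSupercuspidal)
    (hc : ∀ v : HeightOneSpectrum (𝓞 ↥(maximalRealSubfield L)), (𝔩 v).ContainsAPacket (Pk ξ v))
    (hunr : ∀ᶠ v in Filter.cofinite, (𝔩 v).unr (chosenPkt (Pk ξ) hc v)) :
    (piXi h ξ).fin = ofAPackets (Pk ξ) hc hunr :=
  (piXi_isPacketOf h ξ).fin_eq_ofAPackets h𝔩 hn hc hunr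

/-- The archimedean member set of any witness is that of `piXi h ξ` (board (o-b1): `inf` is pinned by its members only). [cite: Rogawski1990, §12.3 Prop. 12.3.3 p. 178] -/
theorem memInf_eq_memInf_piXi (h : XiPacketsDiscrete 𝔩 𝔞 μ Pk PkInf) (ξ : OneDimAutRepH L)
    {Q' : SpectralPacketG 𝔩 𝔞 μ} (hQ' : Q'.IsPacketOf (Pk ξ) (PkInf ξ)) : 𝔞.memInf Q'.inf = 𝔞.memInf (piXi h ξ).inf :=
  hQ'.memInf_eq (piXi_isPacketOf h ξ)

/-- **The discrete witness**: some member family of `Π(ξ)` occurs in the discrete spectrum (print: `⊗ πⁿ(ξ_v)`, Thm. 13.3.6 (b)). [cite: Rogawski1990, §13.3 Thm. 13.3.6 (b) p. 202] -/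
theorem piXi_exists_mem_occurs (h : XiPacketsDiscrete 𝔩 𝔞 μ Pk PkInf) (ξ : OneDimAutRepH L) :
    ∃ π : ∀ v : HeightOneSpectrum (𝓞 ↥(maximalRealSubfield L)), IrrClass ((cmDatum L 3 H').Local v),
      (piXi h ξ).fin.Mem π ∧ F0P3GlobalPacketDiscrete.cmOccursInDiscreteSpectrum L 3 H' μ π :=
  (piXi h ξ).exists_mem_occurs

end Summit.HodgeConjecture.HodgeConjecture.Cruxes.H413.F0P3SpectralPacket.SpectralPacketG

/-! ## §3 The slot `ρXi` [§12.1 type (3); §13.1 p. 199] -/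

namespace Summit.HodgeConjecture.HodgeConjecture.Cruxes.H413.F0P3GlobalPacket.GlobalPacketH

variable {L : Type} [Field L] [NumberField L] [IsCMField L] {H' : Matrix (Fin 3) (Fin 3) L}
  {𝔩 : ∀ v : HeightOneSpectrum (𝓞 ↥(maximalRealSubfield L)), LocalPacketKit L H' v}

/-- **(e3) `rhoXi h8 ξ` — THE TUPLE'S `ρXi ξ = ξ` AS A GLOBAL `H`-PACKET**: the singleton packet family `{⟦ξ_v⟧}_v` of the local components `ξ_v = ξ.xiLocalChar v` (★ FILE 3c
`charPacket` under (ℓ8) `OneDimHLaw`; the open-kernel side condition is ★ `isOpen_ker_xiLocalChar`) — hypothesis-free but for (ℓ8). [cite: Rogawski1990, §13.1 p. 199; §12.1 p. 171] -/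
def rhoXi (h8 : ∀ v : HeightOneSpectrum (𝓞 ↥(maximalRealSubfield L)), (𝔩 v).OneDimHLaw) (ξ : OneDimAutRepH L) : GlobalPacketH 𝔩 :=
  charPacket h8 (fun v => ξ.xiLocalChar v) (fun v => F0P3XiLocalCharOpenKernel.isOpen_ker_xiLocalChar L ξ v)

/-- `rhoXi h8 ξ` IS `ξ`'s packet family. [cite: Rogawski1990, §12.1 p. 171] -/
theorem rhoXi_isCharPacket (h8 : ∀ v : HeightOneSpectrum (𝓞 ↥(maximalRealSubfield L)), (𝔩 v).OneDimHLaw) (ξ : OneDimAutRepH L) :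
    (rhoXi h8 ξ).IsCharPacket (fun v => ξ.xiLocalChar v) (fun v => F0P3XiLocalCharOpenKernel.isOpen_ker_xiLocalChar L ξ v) :=
  isCharPacket_charPacket h8 _ _

/-- **Uniqueness**: any `H`-packet family with member sets `{⟦ξ_v⟧}` is `rhoXi h8 ξ`. [cite: Rogawski1990, §12.1 p. 171] -/
theorem eq_rhoXi_of_isCharPacket (h8 : ∀ v : HeightOneSpectrum (𝓞 ↥(maximalRealSubfield L)), (𝔩 v).OneDimHLaw) (ξ : OneDimAutRepH L)
    {ρ : GlobalPacketH 𝔩} (hρ : ρ.IsCharPacket (fun v => ξ.xiLocalChar v) (fun v => F0P3XiLocalCharOpenKernel.isOpen_ker_xiLocalChar L ξ v)) :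
    ρ = rhoXi h8 ξ :=
  hρ.eq_charPacket h8 _ _

/-- `(rhoXi h8 ξ).loc v` is ★ FILE 1c's `packetHOfChar` of `ξ_v`. [cite: Rogawski1990, §12.1 p. 171] -/
theorem rhoXi_loc (h8 : ∀ v : HeightOneSpectrum (𝓞 ↥(maximalRealSubfield L)), (𝔩 v).OneDimHLaw) (ξ : OneDimAutRepH L)
    (v : HeightOneSpectrum (𝓞 ↥(maximalRealSubfield L))) :
    (rhoXi h8 ξ).loc v = (𝔩 v).packetHOfChar (h8 v) (ξ.xiLocalChar v) (F0P3XiLocalCharOpenKernel.isOpen_ker_xiLocalChar L ξ v) :=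
  rfl

/-- The member set of `(rhoXi h8 ξ)_v` is `{⟦ξ_v⟧}`. [cite: Rogawski1990, §13.1 p. 199; §12.1 p. 171] -/
theorem memH_rhoXi_loc (h8 : ∀ v : HeightOneSpectrum (𝓞 ↥(maximalRealSubfield L)), (𝔩 v).OneDimHLaw) (ξ : OneDimAutRepH L)
    (v : HeightOneSpectrum (𝓞 ↥(maximalRealSubfield L))) :
    (𝔩 v).memH ((rhoXi h8 ξ).loc v) = {IrrClass.mk (SmoothIrrep.ofChar (ξ.xiLocalChar v) (F0P3XiLocalCharOpenKernel.isOpen_ker_xiLocalChar L ξ v))} :=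
  rhoXi_isCharPacket h8 ξ v

end Summit.HodgeConjecture.HodgeConjecture.Cruxes.H413.F0P3GlobalPacket.GlobalPacketH

end
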